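import Literature.Topology.FourManifolds.SurfaceGroupAmalgam
import Literature.GroupTheory.CombinatorialGroupTheory.SurfaceRelatorPrimitive
import Literature.GroupTheory.CombinatorialGroupTheory.FreeGroupAmalgamSeparation
import Literature.GroupTheory.CombinatorialGroupTheory.FreeGroupCentralizers
import Mathlib.GroupTheory.PushoutI
import HarnessLib

/-!
# The surface group `S_{g+h}` as an explicit amalgam `F_{2g} *_ℤ F_{2h}`

Topic `Literature/GroupTheory/CombinatorialGroupTheory`.  For `g, h ≥ 1` the surface group
`S_{g+h} = ⟨a₁, b₁, …, a_{g+h}, b_{g+h} ∣ ∏ [aᵢ, bᵢ]⟩` (the tree's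
`Literature.Topology.FourManifolds.SurfaceGroup`) is the free product of the free groups
`F⟨a₁, …, b_g⟩` and `F⟨a_{g+1}, …, b_{g+h}⟩` amalgamating the infinite cyclic subgroups generated
by `r_g = ∏_{i ≤ g} [aᵢ, bᵢ]` and by `r_h⁻¹` (Seifert–van Kampen for the surface cut along a
separating curve; Lyndon–Schupp I.7, Serre, *Trees*, I.1.2 Ex. 4).  The tree's
`surfaceGroup_exists_mulEquiv_of_pushout_add` proves this for ANY group with the universal
property; here we instantiate it with Mathlib's honest amalgamated product `Monoid.PushoutI`:

* `surfaceAmalgamElt g h b`, `surfaceAmalgamHom g h b` — the `Bool`-indexed amalgam data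
  (`false ↦ (F_{2g}, ℤ ↦ r_g)`, `true ↦ (F_{2h}, ℤ ↦ r_h⁻¹)`); `SurfaceAmalgam g h` — the pushout;
* `surfaceAmalgamHom_injective` — both maps `ℤ → F` are injective (free groups are torsion
  free, `r ≠ 1`), so the reduced-word theorem applies;
* `exists_surfaceGroup_mulEquiv_surfaceAmalgam` — **`S_{g+h} ≃* F_{2g} *_ℤ F_{2h}`** compatibly
  with the two inclusions of generators;
* the factor hypotheses of the centralizer theorem for amalgams: `surfaceAmalgam_malnormal`
  (the amalgamated `ℤ` is malnormal in each free factor, since `r_g`, `r_h⁻¹` are not proper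
  powers), `surfaceAmalgam_isCyclic_centralizer` (centralizers in the factors are cyclic),
  `surfaceAmalgam_factor_torsionFree`.

## References

* R. C. Lyndon, P. E. Schupp, *Combinatorial Group Theory*, Springer (1977); Classics in
  Mathematics (2001), Ch. I §7, Ch. IV §2. [LyndonSchupp2001]
* J.-P. Serre, *Trees*, Springer (1980), Ch. I §1.2. [SerreTrees1980]
* A. Hatcher, *Algebraic Topology*, CUP (2002), §1.2. [HatcherAT2002]
-/

noncomputable section

namespace Literature.GroupTheory.CombinatorialGroupTheory

open Literature.Topology.FourManifolds Monoid

/-! ### The amalgam data -/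

/-- The number of handles of the factor with index `b`: `g` for `b = false`, `h` for `b = true`
(a `Bool.rec`, so that it computes on the two literals). [cite: LyndonSchupp2001, Ch. I §7] -/
abbrev surfaceAmalgamGenus (g h : ℕ) (b : Bool) : ℕ := Bool.rec (motive := fun _ => ℕ) g h b

/-- The free factor with index `b`: `F⟨a₁,…,b_g⟩` for `b = false`, `F⟨a₁,…,b_h⟩` for `b = true`.
[cite: LyndonSchupp2001, Ch. I §7] -/
abbrev SurfaceAmalgamFactor (g h : ℕ) (b : Bool) : Type := FreeGroup (surfaceGen (surfaceAmalgamGenus g h b))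

/-- The amalgamated elements: `r_g` in the first factor, `r_h⁻¹` in the second (the separating
curve read from the two sides). [cite: LyndonSchupp2001, Ch. I §7] -/
def surfaceAmalgamElt (g h : ℕ) : (b : Bool) → SurfaceAmalgamFactor g h b
  | false => surfaceRelator g
  | true => (surfaceRelator h)⁻¹

/-- The two structure maps `ℤ → F_{2g}`, `1 ↦ r_g`, and `ℤ → F_{2h}`, `1 ↦ r_h⁻¹`.
[cite: LyndonSchupp2001, Ch. I §7] -/
def surfaceAmalgamHom (g h : ℕ) (b : Bool) : Multiplicative ℤ →* SurfaceAmalgamFactor g h b :=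
  zpowersHom _ (surfaceAmalgamElt g h b)

/-- The amalgamated free product `F_{2g} *_ℤ F_{2h}` (Mathlib's `Monoid.PushoutI`).
[cite: SerreTrees1980, Ch. I §1.2] -/
abbrev SurfaceAmalgam (g h : ℕ) : Type := PushoutI (surfaceAmalgamHom g h)

variable {g h : ℕ}

/-- The amalgamated element of the first factor is `r_g`. [cite: LyndonSchupp2001, Ch. I §7] -/
@[simp] theorem surfaceAmalgamElt_false : surfaceAmalgamElt g h false = surfaceRelator g := rfl

/-- The amalgamated element of the second factor is `r_h⁻¹`. [cite: LyndonSchupp2001, Ch. I §7] -/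
@[simp] theorem surfaceAmalgamElt_true : surfaceAmalgamElt g h true = (surfaceRelator h)⁻¹ := rfl

/-- `surfaceAmalgamHom g h b (n) = (r)ⁿ`. [cite: LyndonSchupp2001, Ch. I §7] -/
theorem surfaceAmalgamHom_apply (b : Bool) (n : Multiplicative ℤ) :
    surfaceAmalgamHom g h b n = surfaceAmalgamElt g h b ^ n.toAdd := rfl

/-- The range of each structure map is the cyclic subgroup `⟨r⟩`. [cite: LyndonSchupp2001, Ch. I §7] -/
theorem range_surfaceAmalgamHom (b : Bool) :
    (surfaceAmalgamHom g h b).range = Subgroup.zpowers (surfaceAmalgamElt g h b) := by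
  ext x
  simp only [surfaceAmalgamHom, MonoidHom.mem_range, Subgroup.mem_zpowers_iff, zpowersHom_apply]
  constructor
  · rintro ⟨n, rfl⟩; exact ⟨n.toAdd, rfl⟩
  · rintro ⟨k, rfl⟩; exact ⟨Multiplicative.ofAdd k, rfl⟩

/-- The amalgamated elements are not proper powers (`g, h ≥ 1`). [cite: LyndonSchupp2001, Ch. I Prop. 2.17] -/
theorem surfaceAmalgamElt_pow_prim (hg : 1 ≤ g) (hh : 1 ≤ h) (b : Bool)
    (t : SurfaceAmalgamFactor g h b) (k : ℕ) (ht : t ^ k = surfaceAmalgamElt g h b) : k = 1 := by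
  cases b with
  | false => exact surfaceRelator_pow_prim hg t k ht
  | true => exact surfaceRelator_inv_pow_prim hh t k ht

/-- The amalgamated elements are non-trivial (`g, h ≥ 1`). [cite: LyndonSchupp2001, Ch. I §7] -/
theorem surfaceAmalgamElt_ne_one (hg : 1 ≤ g) (hh : 1 ≤ h) (b : Bool) :
    surfaceAmalgamElt g h b ≠ 1 :=
  ne_one_of_pow_prim (surfaceAmalgamElt_pow_prim hg hh b)

/-- **Injectivity** of the structure maps: the amalgam is honest. [cite: SerreTrees1980, Ch. I §1.2] -/
theorem surfaceAmalgamHom_injective (hg : 1 ≤ g) (hh : 1 ≤ h) (b : Bool) :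
    Function.Injective (surfaceAmalgamHom g h b) :=
  zpowersHom_injective (surfaceAmalgamElt_ne_one hg hh b)

/-! ### The identification with the surface group -/

/-- The relation `of₀(r_g) · of₁(r_h) = 1` holds in the amalgam. [cite: HatcherAT2002, §1.2] -/
theorem of_surfaceRelator_mul_of_surfaceRelator :
    (PushoutI.of (φ := surfaceAmalgamHom g h) false (surfaceRelator g) : SurfaceAmalgam g h) *
      PushoutI.of (φ := surfaceAmalgamHom g h) true (surfaceRelator h) = 1 := by
  have h0 : (surfaceRelator g : SurfaceAmalgamFactor g h false) =
      surfaceAmalgamHom g h false (Multiplicative.ofAdd 1) := by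
    rw [surfaceAmalgamHom_apply, surfaceAmalgamElt_false, toAdd_ofAdd, zpow_one]
  have h1 : (surfaceRelator h : SurfaceAmalgamFactor g h true) =
      (surfaceAmalgamHom g h true (Multiplicative.ofAdd 1))⁻¹ := by
    rw [surfaceAmalgamHom_apply, surfaceAmalgamElt_true, toAdd_ofAdd, zpow_one, inv_inv]
  rw [h0, h1, map_inv, PushoutI.of_apply_eq_base, PushoutI.of_apply_eq_base, mul_inv_cancel]

/-- **`S_{g+h} ≅ F_{2g} *_ℤ F_{2h}`** (`g, h` arbitrary; for the normal form theorem one needs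
`g, h ≥ 1`): an isomorphism carrying the first `g` handles to the factor `false` and the last `h`
handles to the factor `true`. [cite: SerreTrees1980, Ch. I §1.2 Ex. 4] -/
theorem exists_surfaceGroup_mulEquiv_surfaceAmalgam (g h : ℕ) :
    ∃ e : SurfaceGroup (g + h) ≃* SurfaceAmalgam g h,
      e.toMonoidHom.comp ((PresentedGroup.mk _).comp (genInclAdd g h)) =
          PushoutI.of (φ := surfaceAmalgamHom g h) false ∧
        e.toMonoidHom.comp ((PresentedGroup.mk _).comp (genShiftAdd g h)) =
          PushoutI.of (φ := surfaceAmalgamHom g h) true := by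
  have hu := of_surfaceRelator_mul_of_surfaceRelator (g := g) (h := h)
  refine surfaceGroup_exists_mulEquiv_of_pushout_add (g := g) (h := h) (Γ := SurfaceAmalgam g h)
    (PushoutI.of (φ := surfaceAmalgamHom g h) false) (PushoutI.of (φ := surfaceAmalgamHom g h) true)
    hu ?_ ?_
  · -- existence: the universal property of the pushout
    let k : Multiplicative ℤ →* SurfaceGroup (g + h) :=
      zpowersHom _ (PresentedGroup.mk _ (genInclAdd g h (surfaceRelator g)))
    let f : (b : Bool) → SurfaceAmalgamFactor g h b →* SurfaceGroup (g + h) := fun b =>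
      Bool.rec (motive := fun b => SurfaceAmalgamFactor g h b →* SurfaceGroup (g + h))
        ((PresentedGroup.mk _).comp (genInclAdd g h)) ((PresentedGroup.mk _).comp (genShiftAdd g h)) b
    have hf : ∀ b, (f b).comp (surfaceAmalgamHom g h b) = k := by
      intro b
      refine MonoidHom.ext_mint ?_
      have hrel : PresentedGroup.mk ({surfaceRelator (g + h)} : Set (FreeGroup (surfaceGen (g + h))))
          (genInclAdd g h (surfaceRelator g)) *
          PresentedGroup.mk ({surfaceRelator (g + h)} : Set (FreeGroup (surfaceGen (g + h))))
          (genShiftAdd g h (surfaceRelator h)) = 1 := by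
        rw [← map_mul, ← surfaceRelator_add]
        exact (PresentedGroup.mk_eq_one_iff).2 (Subgroup.subset_normalClosure rfl)
      cases b with
      | false =>
        change PresentedGroup.mk _ (genInclAdd g h (surfaceRelator g ^ Multiplicative.toAdd
          (Multiplicative.ofAdd (1 : ℤ)))) = PresentedGroup.mk _ (genInclAdd g h (surfaceRelator g)) ^
          Multiplicative.toAdd (Multiplicative.ofAdd (1 : ℤ))
        rw [toAdd_ofAdd, zpow_one, zpow_one]
      | true =>
        change PresentedGroup.mk _ (genShiftAdd g h ((surfaceRelator h)⁻¹ ^ Multiplicative.toAdd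
          (Multiplicative.ofAdd (1 : ℤ)))) = PresentedGroup.mk _ (genInclAdd g h (surfaceRelator g)) ^
          Multiplicative.toAdd (Multiplicative.ofAdd (1 : ℤ))
        rw [toAdd_ofAdd, zpow_one, zpow_one, map_inv, map_inv, inv_eq_iff_mul_eq_one, mul_eq_one_comm]
        exact hrel
    refine ⟨PushoutI.lift f k hf, ?_, ?_⟩
    · exact MonoidHom.ext fun x => PushoutI.lift_of f k hf (i := false) x
    · exact MonoidHom.ext fun x => PushoutI.lift_of f k hf (i := true) x
  · -- uniqueness
    intro F F' h₁ h₂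
    refine PushoutI.hom_ext_nonempty fun b => ?_
    cases b with
    | false => exact h₁
    | true => exact h₂

/-! ### The factor hypotheses of the centralizer theorem -/

/-- **Malnormality of the amalgamated `ℤ` in each factor**: if `x ∉ ⟨r⟩` and `x rⁿ x⁻¹ ∈ ⟨r⟩`
then `n = 0` (`r = r_g` resp. `r_h⁻¹` is not a proper power in a free group).
[cite: LyndonSchupp2001, Ch. I Prop. 2.17] -/
theorem surfaceAmalgam_malnormal (hg : 1 ≤ g) (hh : 1 ≤ h) (b : Bool)
    (x : SurfaceAmalgamFactor g h b) (hx : x ∉ (surfaceAmalgamHom g h b).range)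
    (c : Multiplicative ℤ) (hc : x * surfaceAmalgamHom g h b c * x⁻¹ ∈ (surfaceAmalgamHom g h b).range) :
    c = 1 := by
  rw [range_surfaceAmalgamHom] at hx hc
  rw [surfaceAmalgamHom_apply] at hc
  have := FreeGroup.eq_zero_of_conj_zpow_mem_zpowers (surfaceAmalgamElt_pow_prim hg hh b) hx hc
  exact toAdd_eq_zero.1 this

/-- **Centralizers of non-trivial elements of the factors are cyclic** (free groups).
[cite: LyndonSchupp2001, Ch. I Prop. 2.19] -/
theorem surfaceAmalgam_isCyclic_centralizer (b : Bool) (x : SurfaceAmalgamFactor g h b) (hx : x ≠ 1) :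
    IsCyclic (Subgroup.centralizer ({x} : Set (SurfaceAmalgamFactor g h b))) :=
  FreeGroup.isCyclic_centralizer hx

/-- The factors are torsion free (free groups). [cite: LyndonSchupp2001, Ch. I §2] -/
theorem surfaceAmalgam_factor_torsionFree (b : Bool) : IsMulTorsionFree (SurfaceAmalgamFactor g h b) :=
  inferInstance

end Literature.GroupTheory.CombinatorialGroupTheory
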